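import Literature.Algebra.Homology.QuasiIsoToHomology
import Mathlib.Algebra.Homology.Homotopy
import HarnessLib

/-!
# A cochain complex with compatible splittings is homotopy equivalent to its homology with zero differentials
# (Weibel Thm. 3.6.3, proof; Cartan–Eilenberg VI.3.1)

Layer `Literature/Algebra/Homology` (pure homological algebra over Mathlib; constructions + proved lemmas, 0 named facts, no instances,
no notation). Sequel to `Algebra/Homology/QuasiIsoToHomology` (the chain map `toHomologyZeroDifferential C r hr : C ⟶ (H•(C), 0)`
attached to retractions `r` of the cycle inclusions, a quasi-isomorphism). Here, for a cochain complex `C` indexed by `ℤ` in an abelian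
category, given in addition

* sections `s i : Hⁱ(C) ⟶ Zⁱ(C)` of the homology projections (`s ≫ π = 𝟙`), and
* «generalised inverses of the differentials» `t j : Cʲ⁺¹ ⟶ Cʲ` with `t ≫ d = r ≫ (𝟙 - π ≫ s) ≫ ι` (the projection onto the
  boundaries) and `d ≫ t = 𝟙 - r ≫ ι` (the projection off the cycles),

the complex `C` is HOMOTOPY EQUIVALENT to `(H•(C), 0)`:

* `fromHomologyZeroDifferential C s : (H•(C), 0) ⟶ C` (`Hⁱ —s→ Zⁱ —ι→ Cⁱ`), a right inverse of `toHomologyZeroDifferential`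
  on the nose (`fromHomology_comp_toHomology`);
* `homotopyToHomologyCompFromHomology` — the homotopy `toHomology ≫ fromHomology ~ 𝟙_C` with components `-t`;
* **`homotopyEquivZeroDifferential C r hr s hs t ht₁ ht₂ : HomotopyEquiv C (zeroDifferential (up ℤ) (H• C))`**.

Over a FIELD such data always exist (every subspace is a direct summand); that construction is the sequel
`Algebra/Homology/SplitComplexField`. Library only (cell `pub-hodge-ring2`, count-neutral); proves nothing about any crux, route or
conjecture. Mathlib searched (pin v4.32): `Homotopy`, `HomotopyEquiv`, `dNext_eq`, `prevD_eq`, `HomologicalComplex.iCycles_d` (used); no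
homotopy equivalence between a complex and its homology.

## References

* C. A. Weibel, *An introduction to homological algebra* (1994), Thm. 3.6.3 (proof: «every subspace of a vector space is a direct
  summand»), Ex. 1.4.3 (split complexes). [Weibel1994]
* H. Cartan, S. Eilenberg, *Homological Algebra* (1956), VI.3, Thm. 3.1. [CartanEilenberg1956]
-/

noncomputable section

open CategoryTheory CategoryTheory.Category CategoryTheory.Limits HomologicalComplex

universe v u

namespace Literature.Algebra.Homology

variable {V : Type u} [Category.{v} V] [Abelian V] (C : CochainComplex V ℤ)
  (r : ∀ i, C.X i ⟶ C.cycles i) (hr : ∀ i, C.iCycles i ≫ r i = 𝟙 _)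
  (s : ∀ i, C.homology i ⟶ C.cycles i) (t : ∀ j : ℤ, C.X (j + 1) ⟶ C.X j)

/-! ### §1 The inclusion `(H•(C), 0) ⟶ C` attached to sections of the homology projections -/

/-- **`(H•(C), 0) ⟶ C`**: in degree `i` the composite `Hⁱ(C) —s i→ Zⁱ(C) —ι→ Cⁱ`; a chain map because `ι ≫ d = 0`.
[cite: Weibel1994, Thm. 3.6.3 (proof)] -/
def fromHomologyZeroDifferential : zeroDifferential (ComplexShape.up ℤ) (fun i => C.homology i) ⟶ C where
  f i := s i ≫ C.iCycles i
  comm' i j _ := by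
    change (s i ≫ C.iCycles i) ≫ C.d i j = (0 : C.homology i ⟶ C.homology j) ≫ s j ≫ C.iCycles j
    rw [assoc, iCycles_d, comp_zero, zero_comp]

/-- The components of `fromHomologyZeroDifferential` (`rfl`). [cite: Weibel1994, Thm. 3.6.3 (proof)] -/
@[simp] theorem fromHomologyZeroDifferential_f (i : ℤ) : (fromHomologyZeroDifferential C s).f i = s i ≫ C.iCycles i := rfl

/-- **`(H•(C), 0) ⟶ C ⟶ (H•(C), 0)` is the identity** (`s ≫ ι ≫ r ≫ π = s ≫ π = 𝟙`). [cite: Weibel1994, Thm. 3.6.3 (proof)] -/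
theorem fromHomology_comp_toHomology (hs : ∀ i, s i ≫ C.homologyπ i = 𝟙 _) :
    fromHomologyZeroDifferential C s ≫ toHomologyZeroDifferential C r hr = 𝟙 _ := by
  ext i
  change (s i ≫ C.iCycles i) ≫ r i ≫ C.homologyπ i = 𝟙 (C.homology i)
  rw [assoc, ← assoc (C.iCycles i), hr, id_comp, hs]

/-! ### §2 The homotopy `C ⟶ (H•(C), 0) ⟶ C ~ 𝟙_C` -/

/-- Transport of `ht₁` along `j + 1 = i`. [cite: Weibel1994, Ex. 1.4.3] -/
theorem eqToHom_t_comp_d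
    (ht₁ : ∀ j : ℤ, t j ≫ C.d j (j + 1) = r (j + 1) ≫ (𝟙 _ - C.homologyπ (j + 1) ≫ s (j + 1)) ≫ C.iCycles (j + 1))
    (j i : ℤ) (h : j + 1 = i) :
    (eqToHom (congrArg C.X h.symm) ≫ t j) ≫ C.d j i = r i ≫ (𝟙 _ - C.homologyπ i ≫ s i) ≫ C.iCycles i := by
  subst h
  rw [eqToHom_refl, id_comp, ht₁]

/-- Transport of `ht₂` along `j + 1 = i`. [cite: Weibel1994, Ex. 1.4.3] -/
theorem d_comp_eqToHom_t (ht₂ : ∀ j : ℤ, C.d j (j + 1) ≫ t j = 𝟙 _ - r j ≫ C.iCycles j) (j i : ℤ) (h : j + 1 = i) :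
    C.d j i ≫ eqToHom (congrArg C.X h.symm) ≫ t j = 𝟙 _ - r j ≫ C.iCycles j := by
  subst h
  rw [eqToHom_refl, id_comp, ht₂]

/-- **The homotopy `toHomology ≫ fromHomology ~ 𝟙_C`** with components `-t`: `d(-t) + (-t)d + 𝟙 = r ≫ π ≫ s ≫ ι`.
[cite: Weibel1994, Thm. 3.6.3 (proof)] [cite: Weibel1994, Ex. 1.4.3] -/
def homotopyToHomologyCompFromHomology
    (ht₁ : ∀ j : ℤ, t j ≫ C.d j (j + 1) = r (j + 1) ≫ (𝟙 _ - C.homologyπ (j + 1) ≫ s (j + 1)) ≫ C.iCycles (j + 1))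
    (ht₂ : ∀ j : ℤ, C.d j (j + 1) ≫ t j = 𝟙 _ - r j ≫ C.iCycles j) :
    Homotopy (toHomologyZeroDifferential C r hr ≫ fromHomologyZeroDifferential C s) (𝟙 C) where
  hom i j := if h : j + 1 = i then -(eqToHom (congrArg C.X h.symm) ≫ t j) else 0
  zero i j hij := dif_neg hij
  comm n := by
    rw [dNext_eq _ (show (ComplexShape.up ℤ).Rel n (n + 1) from rfl),
      prevD_eq _ (show (ComplexShape.up ℤ).Rel (n - 1) n by simp), dif_pos rfl, dif_pos (show n - 1 + 1 = n by omega),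
      Preadditive.comp_neg, Preadditive.neg_comp, d_comp_eqToHom_t C r t ht₂ n (n + 1) rfl,
      eqToHom_t_comp_d C r s t ht₁ (n - 1) n (by omega)]
    change (r n ≫ C.homologyπ n) ≫ s n ≫ C.iCycles n = _ + _ + 𝟙 (C.X n)
    simp only [Preadditive.comp_sub, Preadditive.sub_comp, id_comp, assoc, neg_sub]
    abel

/-- **`C ≃ₕ (H•(C), 0)`**: a cochain complex with retractions of the cycle inclusions, sections of the homology projections and
compatible generalised inverses of the differentials is homotopy equivalent to its homology with zero differentials.
[cite: Weibel1994, Thm. 3.6.3] [cite: CartanEilenberg1956, VI.3 Thm. 3.1] -/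
def homotopyEquivZeroDifferential (hs : ∀ i, s i ≫ C.homologyπ i = 𝟙 _)
    (ht₁ : ∀ j : ℤ, t j ≫ C.d j (j + 1) = r (j + 1) ≫ (𝟙 _ - C.homologyπ (j + 1) ≫ s (j + 1)) ≫ C.iCycles (j + 1))
    (ht₂ : ∀ j : ℤ, C.d j (j + 1) ≫ t j = 𝟙 _ - r j ≫ C.iCycles j) :
    HomotopyEquiv C (zeroDifferential (ComplexShape.up ℤ) (fun i => C.homology i)) where
  hom := toHomologyZeroDifferential C r hr
  inv := fromHomologyZeroDifferential C s
  homotopyHomInvId := homotopyToHomologyCompFromHomology C r hr s t ht₁ ht₂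
  homotopyInvHomId := Homotopy.ofEq (fromHomology_comp_toHomology C r hr s hs)

end Literature.Algebra.Homology

end
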